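import Literature.NumberTheory.GaloisRepresentations.TwistedSumFiniteOrder
import Literature.NumberTheory.GaloisRepresentations.TwistedSumFiniteOrderGeneric
import Literature.NumberTheory.GaloisRepresentations.TwistedSumAssembly
import HarnessLib

/-!
# Twisted sums with a twist of prime order: the one-generator unscrewing for continuous
# semisimple representations (finite-order companion of HLTT Prop. 7.12)

Topic `Literature/NumberTheory/GaloisRepresentations` (theorems only).  The topological form of
`TwistedSum.exists_halving_of_generic_twist` (`TwistedSumFiniteOrder`), in the setting of
Harris–Lan–Taylor–Thorne 2016, Prop. 7.12 (`TwistedSumAssembly.exists_framedRep_of_unbounded`) but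
for a twisting character of PRIME order `p` and a continuous automorphism `θ` of the group playing
the quadratic twist: `Γ` a topological group, `D ⊆ Γ` dense, `k` an algebraically closed Hausdorff
topological field of characteristic `0`, `μ : Γ → kˣ` continuous with `μ^p = 1` and
`μ ∘ θ ∘ θ = μ`, and for `j ∈ J` (all residues `< p` but at most one, `0 ∈ J`) continuous
semisimple `C_j : Γ → GL_{2d}(k)` whose characteristic roots at `σ ∈ D` and at `θ σ` are
`S₁ μ(σ)^j ⊔ S₂ μ(θσ)^j` resp. `S₂ μ(θσ)^j ⊔ S₁ μ(σ)^j` for `d`-element multisets `S₁, S₂` of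
non-zero elements (depending on `σ`), with `charpoly C₀ ∘ θ = charpoly C₀` and `16 d² < p`.
Then (`TwistedSum.exists_framedRep_of_cyclic_twist`) there is a continuous semisimple
`ρ : Γ → GL_d(k)` with `charpoly C₀ (g) = charpoly ρ (g) · charpoly ρ (θ g)` for all `g` and
characteristic roots `S₁` at every `σ ∈ D` where `μ(θσ) ≠ μ(σ)`.

This is the group-theoretic extraction step of R. Taylor, *l-adic representations associated to
modular forms over imaginary quadratic fields. II*, Invent. Math. 116 (1994), §3, for cyclic twists
of large prime order (there: `Γ = Γ_F`, `θ` = conjugation by a lift of the non-trivial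
automorphism of the quadratic `F/F₀`, `μ` = the `ℓ`-adic avatar of the twisting character,
`C_j` = the induced packages of its powers restricted to `Γ_F`, `D` = Frobenius elements).

*Proof.*  `ν := (μ ∘ θ)/μ` has `ν^p = 1`, `ν ∘ θ = ν⁻¹`, `ν ≠ 1`; the twisted packages
`C'_j := C_j ⊗ μ^{-j}` have characters `tr C'_j = Σ S₁ + ν^j Σ S₂` on `D`; continuity, density and
Brauer–Nesbitt (`Representation.nonempty_equiv_of_character_eq_of_isSemisimple`) give the identities
of `exists_halving_of_generic_twist` for `χ = ν^k`, where `k` is a generic exponent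
(`card_bad_le`, `exists_generic_exponent`: `#Bad ≤ 4d²`, `4d² + 6 ≤ p`); the resulting `U ≤ C'_k`
has roots `S₁` by the mass separation `multiset_eq_of_twist_pair` (`#Y + #S₂ ≤ 3d < p`), hence
dimension `d`, and is framed by a basis (`ContinuousRep.frame`).

## References

* R. Taylor, Invent. Math. 116 (1994), §3. [Taylor1994]
* M. Harris, K.-W. Lan, R. Taylor, J. Thorne, Res. Math. Sci. 3:37 (2016), §7, Prop. 7.12.
  [HarrisLanTaylorThorneRMS2016]
-/

noncomputable section

open Polynomial
open scoped MonoidAlgebra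

namespace Literature.NumberTheory.GaloisRepresentations

namespace TwistedSum

open Literature.RepresentationTheory.Semisimple Literature.RepresentationTheory.FiniteGroups
open _root_.Topology

variable {Γ : Type} [Group Γ] [TopologicalSpace Γ] [IsTopologicalGroup Γ]
  {k : Type} [Field k] [IsAlgClosed k] [CharZero k] [TopologicalSpace k]
  [IsTopologicalDivisionRing k] [T2Space k]

omit [IsTopologicalGroup Γ] [IsAlgClosed k] [CharZero k] [IsTopologicalDivisionRing k] [T2Space k] in
/-- Roots of the characteristic polynomial of a scalar multiple of `ρ(g)` (as an endomorphism of
`kⁿ`) are the roots of `charpoly ρ(g)` scaled. [folklore] -/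
theorem roots_charpoly_smul_toRepresentation {n : ℕ} (ρ : FramedRep Γ k n) (g : Γ) {c : k}
    (hc : c ≠ 0) :
    (c • ρ.toRepresentation g).charpoly.roots = (FramedRep.charpoly ρ g).roots.map (c * ·) := by
  rw [roots_charpoly_smul_linearMap _ hc, ← FramedRep.charpoly_eq_charpoly_toRepresentation]

/-- **One-generator unscrewing of cyclic twists of prime order, continuous form** (finite-order
companion of Harris–Lan–Taylor–Thorne 2016, Prop. 7.12; the group-theoretic step of Taylor 1994,
§3).  See the module docstring for the statement in words. [folklore] -/
theorem exists_framedRep_of_cyclic_twist (D : Set Γ) (hD : Dense D) (d p : ℕ) (hp : p.Prime)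
    (hdp : 16 * d ^ 2 < p) (hd : 0 < d) (θ : Γ →ₜ* Γ) (hθ : Function.Bijective θ)
    (μ : Γ →ₜ* kˣ) (hμp : ∀ g, μ g ^ p = 1) (hμθ : ∀ g, μ (θ (θ g)) = μ g)
    (J : Set ℕ) (h0J : 0 ∈ J) (hJ : (Set.Iio p \ J).Subsingleton)
    (C : ℕ → FramedRep Γ k (2 * d)) (hss : ∀ j ∈ J, (C j).toContinuousRep.IsSemisimple)
    (hθ0 : ∀ g, FramedRep.charpoly (C 0) (θ g) = FramedRep.charpoly (C 0) g)
    (hroots : ∀ σ ∈ D, ∃ S₁ S₂ : Multiset k, Multiset.card S₁ = d ∧ Multiset.card S₂ = d ∧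
      (0 : k) ∉ S₁ ∧ (0 : k) ∉ S₂ ∧
      (∀ j ∈ J, (FramedRep.charpoly (C j) σ).roots =
        S₁.map (· * ((μ σ : kˣ) : k) ^ j) + S₂.map (· * ((μ (θ σ) : kˣ) : k) ^ j)) ∧
      (∀ j ∈ J, (FramedRep.charpoly (C j) (θ σ)).roots =
        S₂.map (· * ((μ (θ σ) : kˣ) : k) ^ j) + S₁.map (· * ((μ σ : kˣ) : k) ^ j)))
    (hne : ∃ σ ∈ D, μ (θ σ) ≠ μ σ) :
    ∃ ρ : FramedRep Γ k d, ρ.toContinuousRep.IsSemisimple ∧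
      (∀ g, FramedRep.charpoly (C 0) g = FramedRep.charpoly ρ g * FramedRep.charpoly ρ (θ g)) ∧
      ∀ σ ∈ D, μ (θ σ) ≠ μ σ → ∀ S₁ S₂ : Multiset k, (0 : k) ∉ S₁ → (0 : k) ∉ S₂ →
        Multiset.card S₂ = d →
        (∀ j ∈ J, (FramedRep.charpoly (C j) σ).roots =
          S₁.map (· * ((μ σ : kˣ) : k) ^ j) + S₂.map (· * ((μ (θ σ) : kˣ) : k) ^ j)) →
        (FramedRep.charpoly ρ σ).roots = S₁ := by
  classical
  /- ### Step 0: characters, the ratio character `ν = (μ ∘ θ)/μ`. -/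
  let μ' : Γ →* kˣ := μ
  let θ' : Γ →* Γ := θ
  have hθsurj : Function.Surjective θ' := hθ.2
  let ν : Γ →* kˣ := (μ'.comp θ') * μ'⁻¹
  have hν : ∀ g, ν g = μ (θ g) * (μ g)⁻¹ := fun g => rfl
  have hνv : ∀ g, ((ν g : kˣ) : k) = ((μ (θ g) : kˣ) : k) * (((μ g : kˣ) : k))⁻¹ := fun g => by
    rw [hν, Units.val_mul, Units.val_inv_eq_inv_val]
  have hνp : ∀ g, ν g ^ p = 1 := fun g => by rw [hν, mul_pow, inv_pow, hμp, hμp, mul_inv_cancel]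
  have hνθ : ∀ g, ν (θ g) = (ν g)⁻¹ := fun g => by
    rw [hν, hν, hμθ, mul_inv_rev, inv_inv]
  obtain ⟨σ₀, hσ₀D, hσ₀⟩ := hne
  have hν1 : ν ≠ 1 := by
    intro h
    have h1 : ν σ₀ = 1 := by rw [h, MonoidHom.one_apply]
    rw [hν, mul_inv_eq_one] at h1
    exact hσ₀ h1
  -- continuity
  have hcμ : Continuous fun g => ((μ g : kˣ) : k) := Units.continuous_val.comp μ.continuous_toFun
  have hcμj : ∀ j : ℕ, Continuous fun g => (((μ g : kˣ) : k) ^ j)⁻¹ := fun j =>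
    (hcμ.pow j).inv₀ fun g => pow_ne_zero _ (Units.ne_zero _)
  have hcν : Continuous fun g => ((ν g : kˣ) : k) := by
    simp only [hνv]
    exact (hcμ.comp θ.continuous_toFun).mul (hcμ.inv₀ fun g => Units.ne_zero _)
  /- ### Step 1: the twisted packages `Rep j = C j ⊗ μ^{-j}` and their characters on `D`. -/
  let R : ℕ → Representation k Γ (Fin (2 * d) → k) := fun j => (C j).toRepresentation
  let Rep : ℕ → Representation k Γ (Fin (2 * d) → k) := fun j => Representation.twist (R j) (μ' ^ j)⁻¹
  have hssR : ∀ j ∈ J, (R j).IsSemisimpleRepresentation := hss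
  have hssRep : ∀ j ∈ J, (Rep j).IsSemisimpleRepresentation := fun j hj => by
    haveI := hssR j hj; infer_instance
  have hRep0 : Rep 0 = R 0 := by
    refine MonoidHom.ext fun g => LinearMap.ext fun v => ?_
    change Representation.twist (R 0) (μ' ^ 0)⁻¹ g v = R 0 g v
    rw [Representation.twist_apply_apply, MonoidHom.inv_apply, MonoidHom.pow_apply, pow_zero, inv_one,
      Units.val_one, one_smul]
  have hcharR : ∀ j, (R j).character = (C j).trace := fun j => FramedRep.character_toRepresentation (C j)
  have hcontR : ∀ j, Continuous (R j).character := fun j => by rw [hcharR]; exact FramedRep.continuous_trace _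
  have hμjv : ∀ (j : ℕ) (g : Γ), (((μ' ^ j)⁻¹ g : kˣ) : k) = (((μ g : kˣ) : k) ^ j)⁻¹ := fun j g => by
    rw [MonoidHom.inv_apply, MonoidHom.pow_apply, Units.val_inv_eq_inv_val, Units.val_pow_eq_pow_val]
    rfl
  have hcharRep : ∀ j g, (Rep j).character g = (((μ g : kˣ) : k) ^ j)⁻¹ * (R j).character g := fun j g => by
    change (Representation.twist (R j) (μ' ^ j)⁻¹).character g = _
    rw [Representation.character_twist, hμjv]
  have hcontRep : ∀ j, Continuous (Rep j).character := fun j => by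
    have : (Rep j).character = fun g => (((μ g : kˣ) : k) ^ j)⁻¹ * (R j).character g := funext (hcharRep j)
    rw [this]; exact (hcμj j).mul (hcontR j)
  -- traces from roots
  have htrace : ∀ j σ, (R j).character σ = (FramedRep.charpoly (C j) σ).roots.sum := fun j σ => by
    rw [hcharR, FramedRep.trace, Matrix.trace_eq_sum_roots_charpoly]; rfl
  -- character values on `D`: `tr Rep_j (σ) = Σ S₁ + ν(σ)^j Σ S₂`, `tr Rep_j (θσ) = Σ S₂ + ν(σ)^{-j} Σ S₁`
  have hval : ∀ σ ∈ D, ∃ A₁ A₂ : k, ∀ j ∈ J,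
      (Rep j).character σ = A₁ + A₂ * ((ν σ : kˣ) : k) ^ j ∧
      (Rep j).character (θ σ) = A₂ + A₁ * (((ν σ : kˣ) : k) ^ j)⁻¹ := by
    intro σ hσ
    obtain ⟨S₁, S₂, -, -, -, -, h1, h2⟩ := hroots σ hσ
    have hx : ((μ σ : kˣ) : k) ≠ 0 := Units.ne_zero _
    have hy : ((μ (θ σ) : kˣ) : k) ≠ 0 := Units.ne_zero _
    refine ⟨S₁.sum, S₂.sum, fun j hj => ⟨?_, ?_⟩⟩
    · rw [hcharRep, htrace, h1 j hj, Multiset.sum_add, Multiset.sum_map_mul_right,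
        Multiset.sum_map_mul_right, Multiset.map_id', Multiset.map_id', hνv, mul_pow, inv_pow]
      field_simp
    · rw [hcharRep, htrace, h2 j hj, Multiset.sum_add, Multiset.sum_map_mul_right,
        Multiset.sum_map_mul_right, Multiset.map_id', Multiset.map_id', hνv, mul_pow, inv_pow]
      field_simp
  /- ### Step 2: a generic exponent. -/
  obtain ⟨j₀, hj₀⟩ : ∃ j₀ : ℕ, ∀ j, j < p → j ≠ j₀ → j ∈ J := by
    by_cases h : ∃ j₀, j₀ < p ∧ j₀ ∉ J
    · obtain ⟨j₀, hj₀p, hj₀J⟩ := h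
      refine ⟨j₀, fun j hjp hne => ?_⟩
      by_contra hjJ
      exact hne (hJ ⟨hjp, hjJ⟩ ⟨hj₀p, hj₀J⟩)
    · push Not at h
      exact ⟨p, fun j hjp _ => h j hjp⟩
  haveI hA : (R 0).IsSemisimpleRepresentation := hssR 0 h0J
  obtain ⟨nA, TA, hnA, hTAirr, hcountA⟩ := Representation.exists_decomposition (R 0)
  haveI := hTAirr
  have hdim2 : Module.finrank k (Fin (2 * d) → k) < p := by
    rw [Module.finrank_fin_fun]; nlinarith
  let Bad : Finset ℕ := (Finset.range p).filter fun b => ∃ i i' : Fin nA, Nonempty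
    (Representation.Equiv (TA i').toRepresentation (Representation.twist (TA i).toRepresentation (ν ^ b)))
  have hBad : Bad.card ≤ nA ^ 2 := card_bad_le hp hνp hν1 hdim2 TA hTAirr
  have hBad6 : Bad.card + 6 ≤ p := by
    have h1 : nA ^ 2 ≤ (2 * d) ^ 2 := by
      rw [Module.finrank_fin_fun] at hnA
      exact Nat.pow_le_pow_left hnA 2
    nlinarith
  obtain ⟨kk, hk0, hkp, hkBad, hk1, hk2, hk3, hk4⟩ := exists_generic_exponent hp Bad j₀ hBad6
  have hpk : ¬ p ∣ kk := fun h => absurd (Nat.le_of_dvd hk0 h) (not_le.2 hkp)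
  -- the four exponents and their membership in `J`
  set a := kk with ha_def
  set b := p - kk with hb_def
  set c₂ := 2 * kk % p with hc₂_def
  set b₂ := (p - 2 * kk % p) % p with hb₂_def
  have haJ : a ∈ J := hj₀ a hkp hk1
  have hbJ : b ∈ J := hj₀ b (by omega) hk2
  have hc₂J : c₂ ∈ J := hj₀ c₂ (Nat.mod_lt _ hp.pos) hk3
  have hb₂J : b₂ ∈ J := hj₀ b₂ (Nat.mod_lt _ hp.pos) hk4
  -- genericity of `χ := ν^a`
  let χ : Γ →* kˣ := ν ^ a
  have hχv : ∀ g, ((χ g : kˣ) : k) = ((ν g : kˣ) : k) ^ a := fun g => by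
    change (((ν ^ a) g : kˣ) : k) = _
    rw [MonoidHom.pow_apply, Units.val_pow_eq_pow_val]
  have hθχ : ∀ g, χ (θ' g) = (χ g)⁻¹ := fun g => by
    change (ν ^ a) (θ g) = ((ν ^ a) g)⁻¹
    rw [MonoidHom.pow_apply, MonoidHom.pow_apply, hνθ, inv_pow]
  have hgen : ∀ {X : Type} [AddCommGroup X] [Module k X] [FiniteDimensional k X]
      (Wr : Representation k Γ X) [Wr.IsIrreducible],
      0 < Representation.mult Wr (R 0) → Representation.mult (Representation.twist Wr χ) (R 0) = 0 := by
    intro X _ _ _ Wr _ hW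
    refine generic_of_not_mem_bad TA hcountA ?_ Wr hW
    intro hex
    exact hkBad (Finset.mem_filter.2 ⟨Finset.mem_range.2 hkp, hex⟩)
  /- ### Step 3: the Brauer–Nesbitt identities. -/
  -- powers of `z = ν(σ)`: `z^a z^b = 1`, `z^{2a} = z^{c₂}`, `z^{c₂} z^{b₂} = 1`
  have hzpow : ∀ σ, (((ν σ : kˣ) : k) ^ a * ((ν σ : kˣ) : k) ^ b = 1) ∧
      (((ν σ : kˣ) : k) ^ a * ((ν σ : kˣ) : k) ^ a = ((ν σ : kˣ) : k) ^ c₂) ∧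
      (((ν σ : kˣ) : k) ^ c₂ * ((ν σ : kˣ) : k) ^ b₂ = 1) := by
    intro σ
    set z : k := ((ν σ : kˣ) : k) with hz
    have hzp : z ^ p = 1 := by rw [hz, ← Units.val_pow_eq_pow_val, hνp, Units.val_one]
    refine ⟨?_, ?_, ?_⟩
    · rw [← pow_add, show a + b = p by omega, hzp]
    · rw [← pow_add, ← two_mul, hc₂_def]
      conv_lhs => rw [← Nat.div_add_mod (2 * kk) p, pow_add, pow_mul, hzp, one_pow, one_mul]
    · rw [← pow_add]
      rcases Nat.eq_zero_or_pos c₂ with h0 | hpos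
      · have : b₂ = 0 := by rw [hb₂_def, ← hc₂_def, h0, Nat.sub_zero, Nat.mod_self]
        rw [h0, this, pow_zero]
      · have hlt : c₂ < p := Nat.mod_lt _ hp.pos
        have : b₂ = p - c₂ := by rw [hb₂_def, ← hc₂_def, Nat.mod_eq_of_lt (Nat.sub_lt hp.pos hpos)]
        rw [this, Nat.add_sub_cancel' hlt.le, hzp]
  -- Brauer–Nesbitt from characters agreeing on the dense `D`
  have BN : ∀ {V W : Type} [AddCommGroup V] [Module k V] [FiniteDimensional k V]
      [AddCommGroup W] [Module k W] [FiniteDimensional k W]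
      (ρ₁ : Representation k Γ V) (ρ₂ : Representation k Γ W)
      [ρ₁.IsSemisimpleRepresentation] [ρ₂.IsSemisimpleRepresentation],
      Continuous ρ₁.character → Continuous ρ₂.character →
      (∀ g ∈ D, ρ₁.character g = ρ₂.character g) → Nonempty (Representation.Equiv ρ₁ ρ₂) := by
    intro V W _ _ _ _ _ _ ρ₁ ρ₂ _ _ h1 h2 h
    exact Representation.nonempty_equiv_of_character_eq_of_isSemisimple ρ₁ ρ₂
      (Continuous.ext_on hD h1 h2 fun g hg => h g hg)
  have hctw : ∀ {V : Type} [AddCommGroup V] [Module k V] [FiniteDimensional k V]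
      (ρ₁ : Representation k Γ V) (χ' : Γ →* kˣ), Continuous ρ₁.character →
      Continuous (fun g => ((χ' g : kˣ) : k)) → Continuous (Representation.twist ρ₁ χ').character := by
    intro V _ _ _ ρ₁ χ' h1 h2
    have : (Representation.twist ρ₁ χ').character = fun g => ((χ' g : kˣ) : k) * ρ₁.character g :=
      funext fun g => Representation.character_twist _ _ _
    rw [this]; exact h2.mul h1
  haveI := hssRep a haJ
  haveI := hssRep b hbJ
  haveI := hssRep c₂ hc₂J
  haveI := hssRep b₂ hb₂J
  have hcχ : Continuous fun g => ((χ g : kˣ) : k) := by simp only [hχv]; exact hcν.pow a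
  have hcχχ : Continuous fun g => (((χ * χ) g : kˣ) : k) := by
    simp only [MonoidHom.mul_apply, Units.val_mul]; exact hcχ.mul hcχ
  have hcχi : Continuous fun g => ((χ⁻¹ g : kˣ) : k) := by
    simp only [MonoidHom.inv_apply, Units.val_inv_eq_inv_val]
    exact hcχ.inv₀ fun g => Units.ne_zero _
  have I₁ : Nonempty (Representation.Equiv ((Rep a).prod (Representation.twist (Rep b) χ))
      ((Representation.twist (R 0) χ).prod (R 0))) := by
    refine BN _ _ ?_ ?_ ?_
    · rw [Representation.char_prod]
      exact (hcontRep a).add (hctw _ _ (hcontRep b) hcχ)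
    · rw [Representation.char_prod]
      exact (hctw _ _ (hcontR 0) hcχ).add (hcontR 0)
    · intro g hg
      obtain ⟨A₁, A₂, hv⟩ := hval g hg
      have h0 := (hv 0 h0J).1
      rw [hRep0, pow_zero, mul_one] at h0
      simp only [Representation.char_prod, Pi.add_apply, Representation.character_twist, hχv,
        (hv a haJ).1, (hv b hbJ).1, h0]
      linear_combination A₂ * (hzpow g).1
  have I₂ : Nonempty (Representation.Equiv ((Rep c₂).prod (Representation.twist (Rep b₂) (χ * χ)))
      ((Representation.twist (R 0) (χ * χ)).prod (R 0))) := by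
    refine BN _ _ ?_ ?_ ?_
    · rw [Representation.char_prod]
      exact (hcontRep c₂).add (hctw _ _ (hcontRep b₂) hcχχ)
    · rw [Representation.char_prod]
      exact (hctw _ _ (hcontR 0) hcχχ).add (hcontR 0)
    · intro g hg
      obtain ⟨A₁, A₂, hv⟩ := hval g hg
      have h0 := (hv 0 h0J).1
      rw [hRep0, pow_zero, mul_one] at h0
      simp only [Representation.char_prod, Pi.add_apply, Representation.character_twist,
        MonoidHom.mul_apply, Units.val_mul, hχv, (hv c₂ hc₂J).1, (hv b₂ hb₂J).1, h0]
      obtain ⟨-, h2, h3⟩ := hzpow g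
      rw [h2]
      linear_combination A₂ * h3
  have I₃ : Nonempty (Representation.Equiv ((Rep a).prod (Representation.twist (Rep a) χ))
      ((Representation.twist (R 0) χ).prod (Rep c₂))) := by
    refine BN _ _ ?_ ?_ ?_
    · rw [Representation.char_prod]
      exact (hcontRep a).add (hctw _ _ (hcontRep a) hcχ)
    · rw [Representation.char_prod]
      exact (hctw _ _ (hcontR 0) hcχ).add (hcontRep c₂)
    · intro g hg
      obtain ⟨A₁, A₂, hv⟩ := hval g hg
      have h0 := (hv 0 h0J).1
      rw [hRep0, pow_zero, mul_one] at h0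
      simp only [Representation.char_prod, Pi.add_apply, Representation.character_twist, hχv,
        (hv a haJ).1, (hv c₂ hc₂J).1, h0]
      obtain ⟨-, h2, -⟩ := hzpow g
      rw [← h2]
      ring
  have I₄ : Nonempty (Representation.Equiv ((R 0).comp θ' : Representation k Γ (Fin (2 * d) → k))
      (R 0)) := by
    haveI : Representation.IsSemisimpleRepresentation ((R 0).comp θ') :=
      isSemisimpleRepresentation_comp (R 0) hθsurj
    refine BN ((R 0).comp θ') (R 0) ((hcontR 0).comp θ.continuous_toFun) (hcontR 0) fun g _ => ?_
    change (R 0).character (θ g) = (R 0).character g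
    haveI : Nonempty (Fin (2 * d)) := ⟨⟨0, by omega⟩⟩
    rw [hcharR, FramedRep.trace, FramedRep.trace, Matrix.trace_eq_neg_charpoly_coeff,
      Matrix.trace_eq_neg_charpoly_coeff]
    change -(FramedRep.charpoly (C 0) (θ g)).coeff _ = -(FramedRep.charpoly (C 0) g).coeff _
    rw [hθ0]
  have I₅ : Nonempty (Representation.Equiv ((Rep a).comp θ' : Representation k Γ (Fin (2 * d) → k))
      (Representation.twist (Rep a) χ⁻¹)) := by
    haveI : Representation.IsSemisimpleRepresentation ((Rep a).comp θ') :=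
      isSemisimpleRepresentation_comp (Rep a) hθsurj
    refine BN ((Rep a).comp θ') _ ((hcontRep a).comp θ.continuous_toFun) (hctw _ _ (hcontRep a) hcχi)
      fun g hg => ?_
    obtain ⟨A₁, A₂, hv⟩ := hval g hg
    have hz : ((ν g : kˣ) : k) ^ a ≠ 0 := pow_ne_zero _ (Units.ne_zero _)
    calc Representation.character ((Rep a).comp θ') g
        = (Rep a).character (θ g) := rfl
      _ = A₂ + A₁ * (((ν g : kˣ) : k) ^ a)⁻¹ := (hv a haJ).2
      _ = ((χ⁻¹ g : kˣ) : k) * (Rep a).character g := by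
          rw [(hv a haJ).1, MonoidHom.inv_apply, Units.val_inv_eq_inv_val, hχv]
          field_simp
          ring
      _ = (Representation.twist (Rep a) χ⁻¹).character g := (Representation.character_twist _ _ _).symm
  /- ### Step 4: the algebraic core. -/
  obtain ⟨U, ⟨eA⟩, ⟨eC⟩⟩ := exists_halving_of_generic_twist θ' hθsurj χ hθχ (R 0) (Rep a) (Rep b)
    (Rep c₂) (Rep b₂) I₁ I₂ I₃ I₄ I₅ hgen
  /- ### Step 5: roots of `U` on `D`, dimension of `U`. -/
  have hUroots : ∀ σ ∈ D, μ (θ σ) ≠ μ σ → ∀ S₁ S₂ : Multiset k, (0 : k) ∉ S₁ → (0 : k) ∉ S₂ →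
      Multiset.card S₂ = d →
      (∀ j ∈ J, (FramedRep.charpoly (C j) σ).roots =
        S₁.map (· * ((μ σ : kˣ) : k) ^ j) + S₂.map (· * ((μ (θ σ) : kˣ) : k) ^ j)) →
      (U.toRepresentation σ).charpoly.roots = S₁ := by
    intro σ hσ hμσ S₁ S₂ h0S₁ h0S₂ hcS₂ hr
    set X := (U.toRepresentation σ).charpoly.roots with hX
    set Y := (U.toRepresentation (θ σ)).charpoly.roots with hY
    set z : k := ((ν σ : kˣ) : k) with hz
    have hx0 : ((μ σ : kˣ) : k) ≠ 0 := Units.ne_zero _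
    -- from `A ≃ U ⊕ U ∘ θ`: `S₁ + S₂ = X + Y`
    have h1 : X + Y = S₁ + S₂ := by
      have hA0 := hr 0 h0J
      simp only [pow_zero, mul_one, Multiset.map_id'] at hA0
      rw [← hA0, FramedRep.charpoly_eq_charpoly_toRepresentation,
        show (C 0).toRepresentation σ = R 0 σ from rfl,
        ← LinearEquiv.charpoly_conj eA.toLinearEquiv (R 0 σ), Representation.Equiv.conj_apply_self,
        show (U.toRepresentation.prod (U.toRepresentation.comp θ' : Representation k Γ U.toSubmodule)) σ =
          (U.toRepresentation σ).prodMap (U.toRepresentation (θ σ)) from rfl,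
        LinearMap.charpoly_prodMap, Polynomial.roots_mul
          ((LinearMap.charpoly_monic _).mul (LinearMap.charpoly_monic _)).ne_zero]
    -- from `Rep a ≃ U ⊕ (U ∘ θ) ⊗ χ`: `S₁ + z^a • S₂ = X + z^a • Y`
    have h2 : X + Y.map (z ^ a * ·) = S₁ + S₂.map (z ^ a * ·) := by
      have hRa := hr a haJ
      -- roots of `Rep a σ = (μ σ ^ a)⁻¹ • R a σ`
      have hRepa : (Rep a σ).charpoly.roots = S₁ + S₂.map (z ^ a * ·) := by
        change (Representation.twist (R a) (μ' ^ a)⁻¹ σ).charpoly.roots = _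
        rw [Representation.twist_apply, hμjv, roots_charpoly_smul_toRepresentation (C a) σ
          (inv_ne_zero (pow_ne_zero _ hx0)), hRa, Multiset.map_add, Multiset.map_map, Multiset.map_map]
        congr 1
        · conv_rhs => rw [← Multiset.map_id' S₁]
          refine Multiset.map_congr rfl fun x _ => ?_
          simp only [Function.comp_apply]
          rw [mul_comm x, ← mul_assoc, inv_mul_cancel₀ (pow_ne_zero _ hx0), one_mul]
        · refine Multiset.map_congr rfl fun x _ => ?_
          simp only [Function.comp_apply, hz, hνv]
          rw [mul_pow, inv_pow]
          ring
      rw [← hRepa, ← LinearEquiv.charpoly_conj eC.toLinearEquiv (Rep a σ),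
        Representation.Equiv.conj_apply_self,
        show (U.toRepresentation.prod (Representation.twist
          (U.toRepresentation.comp θ' : Representation k Γ U.toSubmodule) χ)) σ =
          (U.toRepresentation σ).prodMap ((Representation.twist
            (U.toRepresentation.comp θ' : Representation k Γ U.toSubmodule) χ) σ) from rfl,
        LinearMap.charpoly_prodMap, Polynomial.roots_mul
          ((LinearMap.charpoly_monic _).mul (LinearMap.charpoly_monic _)).ne_zero,
        Representation.twist_apply, roots_charpoly_smul_linearMap _ (Units.ne_zero _), hχv]
      rfl
    -- mass separation
    have hzp : z ^ p = 1 := by rw [hz, ← Units.val_pow_eq_pow_val, hνp, Units.val_one]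
    have hz1 : z ≠ 1 := by
      intro h
      apply hμσ
      have : ν σ = 1 := Units.ext h
      rwa [hν, mul_inv_eq_one] at this
    haveI : Fact p.Prime := ⟨hp⟩
    have hza1 : z ^ a ≠ 1 := pow_ne_one_of_lt_orderOf hk0.ne' (by rwa [orderOf_eq_prime hzp hz1])
    have hzap : (z ^ a) ^ p = 1 := by rw [← pow_mul, mul_comm, pow_mul, hzp, one_pow]
    have h0Y : (0 : k) ∉ Y := by
      intro h0
      have : (0 : k) ∈ S₁ + S₂ := by rw [← h1]; exact Multiset.mem_add.2 (Or.inr h0)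
      rcases Multiset.mem_add.1 this with h | h
      · exact h0S₁ h
      · exact h0S₂ h
    have hcard : Multiset.card Y + Multiset.card S₂ < p := by
      have hY2 : Multiset.card Y ≤ 2 * d := by
        have hsplit : Multiset.card Y = Module.finrank k U.toSubmodule := by
          rw [hY, ← LinearMap.charpoly_natDegree (U.toRepresentation (θ σ))]
          exact Polynomial.splits_iff_card_roots.mp (IsAlgClosed.splits _)
        rw [hsplit]
        calc Module.finrank k U.toSubmodule ≤ Module.finrank k (Fin (2 * d) → k) :=
              Submodule.finrank_le _
          _ = 2 * d := Module.finrank_fin_fun k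
      rw [hcS₂]; nlinarith
    exact (multiset_eq_of_twist_pair' hp hzap hza1 h0Y h0S₂ hcard h1 h2).1
  -- dimension of `U`
  have hdU : Module.finrank k U.toSubmodule = d := by
    obtain ⟨S₁, S₂, hc1, hc2, h01, h02, hr, -⟩ := hroots σ₀ hσ₀D
    have h := hUroots σ₀ hσ₀D hσ₀ S₁ S₂ h01 h02 hc2 hr
    have hsplit : Multiset.card (U.toRepresentation σ₀).charpoly.roots = Module.finrank k U.toSubmodule := by
      rw [← LinearMap.charpoly_natDegree (U.toRepresentation σ₀)]
      exact Polynomial.splits_iff_card_roots.mp (IsAlgClosed.splits _)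
    rw [← hsplit, h, hc1]
  /- ### Step 6: framing `U`. -/
  haveI hUss : U.toRepresentation.IsSemisimpleRepresentation :=
    Subrepresentation.isSemisimpleRepresentation_toRepresentation U
  haveI : IsModuleTopology k U.toSubmodule := isModuleTopology_submodule_pi _
  have hMcont : Continuous fun g : Γ =>
      (((C a) g : GL (Fin (2 * d)) k) : Matrix (Fin (2 * d)) (Fin (2 * d)) k) :=
    Units.continuous_val.comp (map_continuous (C a))
  let σU : ContinuousRep Γ k U.toSubmodule := ⟨U.toRepresentation, by
    rw [IsInducing.subtypeVal.continuous_iff]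
    change Continuous fun q : Γ × U.toSubmodule => ((((μ' ^ a)⁻¹) q.1 : kˣ) : k) •
      Matrix.mulVec (((C a) q.1 : GL (Fin (2 * d)) k) : Matrix (Fin (2 * d)) (Fin (2 * d)) k)
        (q.2 : Fin (2 * d) → k)
    have hc : Continuous fun q : Γ × U.toSubmodule => ((((μ' ^ a)⁻¹) q.1 : kˣ) : k) := by
      simp only [hμjv]
      exact (hcμj a).comp continuous_fst
    exact hc.smul ((hMcont.comp continuous_fst).matrix_mulVec
      (continuous_subtype_val.comp continuous_snd))⟩
  let bU := Module.finBasisOfFinrankEq k U.toSubmodule hdU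
  refine ⟨σU.frame bU, ?_, fun g => ?_, fun σ hσ hμσ S₁ S₂ h0S₁ h0S₂ hcS₂ hr => ?_⟩
  · exact Representation.isSemisimpleRepresentation_of_equiv (σU.frameEquiv bU).toRepEquiv.symm
  · have hρ : ∀ g, FramedRep.charpoly (σU.frame bU) g = (U.toRepresentation g).charpoly := fun g => by
      rw [FramedRep.charpoly, ContinuousRep.coe_frame_apply, LinearMap.charpoly_toMatrix]; rfl
    rw [hρ, hρ, FramedRep.charpoly_eq_charpoly_toRepresentation,
      show (C 0).toRepresentation g = R 0 g from rfl,
      ← LinearEquiv.charpoly_conj eA.toLinearEquiv (R 0 g), Representation.Equiv.conj_apply_self,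
      show (U.toRepresentation.prod (U.toRepresentation.comp θ' : Representation k Γ U.toSubmodule)) g =
        (U.toRepresentation g).prodMap (U.toRepresentation (θ g)) from rfl,
      LinearMap.charpoly_prodMap]
  · rw [FramedRep.charpoly, ContinuousRep.coe_frame_apply, LinearMap.charpoly_toMatrix]
    exact hUroots σ hσ hμσ S₁ S₂ h0S₁ h0S₂ hcS₂ hr

end TwistedSum

end Literature.NumberTheory.GaloisRepresentations
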